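import Literature.NumberTheory.Sieve.SingularSeries
import Literature.NumberTheory.Sieve.LargeSieveInequality
import Literature.NumberTheory.Sieve.RamanujanSum
import HarnessLib

/-!
# Green–Tao (2006): the enveloping sieve `β_R` for a monic prime tuple — construction

B. Green, T. Tao, *Restriction theory of the Selberg sieve, with applications*, JTNB **18** (2006)
147–182 [GreenTao2006Restriction], §3 (Prop. 3.1) and Appendix §7 (construction of the
enveloping sieve, after Ramaré–Ruzsa), specialised to `F(n) = ∏_{h ∈ H} (n + h)` for a finite
tuple `H ⊆ ℤ` (so `γ(p) = 1 - ν_H(p)/p` with `ν_H(p)` the tree's `tupleResidueCount H p`).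

This file is the first layer of the proof of the named fact
`Literature.NumberTheory.Sieve.GreenTao2006_envelopingSieve_extension` (`GreenTao2006Restriction.lean`).
Everything here is PROVED; there are no named facts.

## Content

Squarefree moduli `q ≤ R` are encoded by their sets of prime factors: `levelSets R` is the family
of sets `S` of primes `≤ R` with `∏ S ≤ R` (so `S ↦ ∏ S` is a bijection onto the squarefree
`q ≤ R`).  With `x_p(n) = 1[p ∤ F(n)]` (`localInd`), `γ_p = 1 - ν_p/p` (`localDensity`),
`h_p = ν_p/(p - ν_p)` (`localH`, GT's `h(p) = (1-γ(p))/γ(p)`) and the mean-zero function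
`u_p = x_p/γ_p - 1` on `ℤ/pℤ` (`localU`):

* `alphaR H R n = ∑_{S ∈ levelSets R} ∏_{p ∈ S} u_p(n)` — this is GT's `α_R` in the form (7.17):
  expanding the product, `∏_{p∈S}(x_p/γ_p - 1) = ∑_{d r = q} μ(d) 1_{(r,F(n))=1}/γ(r)` (`q = ∏ S`);
* `selbergG H R = ∑_{S ∈ levelSets R} ∏_{p∈S} h_p` — GT's `G(R) = ∑_{q ≤ R} h(q)` (7.13);
* `betaR H R n = alphaR² / G(R)` — GT's `β_R` (7.14);
* `alphaR_eq_selbergG`: `α_R(n) = G(R)` for `n ∈ X_{R!}` (GT Lemma 7.5; here immediate since every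
  factor `u_p(n)` equals `h_p`), hence `betaR_eq_selbergG`: `β_R = G(R)` on `X_{R!}`;
* `abs_alphaR_le`: `|α_R(n)| ≤ G(R) · #{M ⊆ Z(n) : ∏ M ≤ R}` with `Z(n)` the primes `p ≤ R`
  dividing `F(n)` (from `u_p(n) ∈ {h_p, -1}`; replaces GT Lemmas 7.7–7.8), hence
  `betaR_le`: `β_R(n) ≤ G(R) · #{…}²`;
* the finite Fourier analysis on `ℤ/pℤ` used by the expansion of `β_R` (GT Prop. 7.1):
  `dftCoeff`, `dft_inversion`, and for `u_p`: `dftCoeff_localU_zero` (`û_p(0) = 0`),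
  `norm_dftCoeff_localU_le` (`|û_p(c)| ≤ h_p`), `norm_dftCoeff_localU_sq_le` (`|(u_p²)^(c)| ≤ h_p`).

## References

* [GreenTao2006Restriction] B. Green, T. Tao, JTNB 18 (2006), §3 Prop. 3.1, §7 (7.12)–(7.17),
  Lemma 7.5, Prop. 7.1 (arXiv:math/0405581).
* O. Ramaré, I. Z. Ruzsa, *Additive properties of dense subsets of sifted sequences*, JTNB 13
  (2001) 559–581 (the enveloping sieve).
-/

noncomputable section

open Finset Real Complex
open scoped FourierTransform ComplexConjugate

namespace Literature.NumberTheory.Sieve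

namespace GreenTao2006

open LargeSieve (e e_add e_int norm_e conj_e e_zero e_eq_exp)

variable (H : Finset ℤ)

/-! ### Local data at a prime `p` -/

/-- `x_p(n) = 1` if `p ∤ ∏_{h ∈ H} (n + h)` (i.e. `n mod p ∈ X_p` in the notation of
[GreenTao2006Restriction, §3]) and `0` otherwise. [cite: GreenTao2006Restriction, §3 and §7 (7.1)] -/
def localInd (p : ℕ) (n : ℤ) : ℝ :=
  if ∀ h ∈ H, ¬ ((p : ℤ) ∣ n + h) then 1 else 0

/-- `γ_p = γ(p) = 1 - ν_H(p)/p`, the density of `X_p` for `F(n) = ∏_{h∈H}(n+h)`.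
[cite: GreenTao2006Restriction, (1.2) and (7.1)] -/
def localDensity (p : ℕ) : ℝ :=
  1 - (tupleResidueCount H p : ℝ) / p

/-- `h_p = h(p) = (1 - γ(p))/γ(p) = ν_H(p)/(p - ν_H(p))`. [cite: GreenTao2006Restriction, (7.12)] -/
def localH (p : ℕ) : ℝ :=
  (tupleResidueCount H p : ℝ) / ((p : ℝ) - tupleResidueCount H p)

/-- `u_p(n) = x_p(n)/γ_p - 1`, the mean-zero normalised indicator of `X_p`; the summand of
GT's `α_R` at a prime (cf. (7.16)–(7.17)). [cite: GreenTao2006Restriction, (7.15)–(7.17)] -/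
def localU (p : ℕ) (n : ℤ) : ℝ :=
  localInd H p n / localDensity H p - 1

/-- The squarefree numbers `q ≤ R`, encoded by their prime factor sets: all sets `S` of primes
`≤ R` with `∏_{p ∈ S} p ≤ R`. [folklore] -/
def levelSets (R : ℕ) : Finset (Finset ℕ) :=
  (Nat.primesLE R).powerset.filter (fun S => ∏ p ∈ S, p ≤ R)

/-- `G(R) = ∑_{q ≤ R} h(q) = ∑_{S ∈ levelSets R} ∏_{p ∈ S} h_p`.
[cite: GreenTao2006Restriction, (7.13)] -/
def selbergG (R : ℕ) : ℝ :=
  ∑ S ∈ levelSets R, ∏ p ∈ S, localH H p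

/-- `α_R(n) = ∑_{S ∈ levelSets R} ∏_{p ∈ S} u_p(n)` (`= ∑_{dr ≤ R} μ(d) γ(r)⁻¹ 1_{(r,F(n))=1}`,
GT (7.17)). [cite: GreenTao2006Restriction, (7.15)–(7.17)] -/
def alphaR (R : ℕ) (n : ℤ) : ℝ :=
  ∑ S ∈ levelSets R, ∏ p ∈ S, localU H p n

/-- The enveloping sieve `β_R(n) = α_R(n)² / G(R)`. [cite: GreenTao2006Restriction, (7.14)] -/
def betaR (R : ℕ) (n : ℤ) : ℝ :=
  alphaR H R n ^ 2 / selbergG H R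

variable {H}

/-- `ν_H(p) ≤ p` for `p ≥ 1`. [folklore] -/
theorem tupleResidueCount_le {p : ℕ} (hp : 0 < p) : tupleResidueCount H p ≤ p := by
  haveI : NeZero p := NeZero.of_pos hp
  have : tupleResidueCount H p ≤ Fintype.card (ZMod p) := Finset.card_le_univ _
  rwa [ZMod.card] at this

/-- `γ_p > 0` at a prime for an admissible tuple. [folklore] -/
theorem localDensity_pos (hadm : IsAdmissibleTuple H) {p : ℕ} (hp : p.Prime) :
    0 < localDensity H p := by
  have hp0 : (0 : ℝ) < p := by exact_mod_cast hp.pos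
  have hν : (tupleResidueCount H p : ℝ) < p := by exact_mod_cast hadm p hp
  unfold localDensity
  rw [sub_pos, div_lt_one hp0]
  exact hν

/-- `γ_p ≤ 1`. [folklore] -/
theorem localDensity_le_one (p : ℕ) : localDensity H p ≤ 1 := by
  unfold localDensity
  have : 0 ≤ (tupleResidueCount H p : ℝ) / p := by positivity
  linarith

/-- `p γ_p = p - ν_p` (`p ≥ 1`). [folklore] -/
theorem mul_localDensity {p : ℕ} (hp : 0 < p) :
    (p : ℝ) * localDensity H p = p - tupleResidueCount H p := by
  have hp0 : (p : ℝ) ≠ 0 := by exact_mod_cast hp.ne'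
  unfold localDensity
  field_simp

/-- `h_p ≥ 0` (`p ≥ 1`). [folklore] -/
theorem localH_nonneg {p : ℕ} (hp : 0 < p) : 0 ≤ localH H p := by
  unfold localH
  have : (tupleResidueCount H p : ℝ) ≤ p := by exact_mod_cast tupleResidueCount_le hp
  exact div_nonneg (Nat.cast_nonneg _) (by linarith)

/-- `h_p = 1/γ_p - 1` for an admissible tuple at a prime. [cite: GreenTao2006Restriction, (7.12)] -/
theorem localH_eq (hadm : IsAdmissibleTuple H) {p : ℕ} (hp : p.Prime) :
    localH H p = 1 / localDensity H p - 1 := by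
  have hp0 : (0 : ℝ) < p := by exact_mod_cast hp.pos
  have hν : (tupleResidueCount H p : ℝ) < p := by exact_mod_cast hadm p hp
  have hγ := localDensity_pos hadm hp
  unfold localH
  unfold localDensity at hγ ⊢
  have h1 : (p : ℝ) - tupleResidueCount H p ≠ 0 := by linarith
  field_simp
  ring

/-- `x_p(n) = 1` when no `n + h` is divisible by `p`. [folklore] -/
theorem localInd_of_forall {p : ℕ} {n : ℤ} (h : ∀ h ∈ H, ¬ ((p : ℤ) ∣ n + h)) :
    localInd H p n = 1 := if_pos h

/-- `x_p(n) = 0` when some `n + h` is divisible by `p`. [folklore] -/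
theorem localInd_of_exists {p : ℕ} {n : ℤ} (h : ∃ h ∈ H, (p : ℤ) ∣ n + h) :
    localInd H p n = 0 := by
  unfold localInd
  rw [if_neg]
  push Not
  exact h

/-- `x_p(n) ∈ {0, 1}`, so `0 ≤ x_p ≤ 1`. [folklore] -/
theorem localInd_nonneg (p : ℕ) (n : ℤ) : 0 ≤ localInd H p n := by
  unfold localInd; split_ifs <;> norm_num

/-- `x_p(n) ≤ 1`. [folklore] -/
theorem localInd_le_one (p : ℕ) (n : ℤ) : localInd H p n ≤ 1 := by
  unfold localInd; split_ifs <;> norm_num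

/-- `u_p(n) = h_p` when `p ∤ F(n)`. [cite: GreenTao2006Restriction, proof of Lemma 7.5] -/
theorem localU_of_forall (hadm : IsAdmissibleTuple H) {p : ℕ} (hp : p.Prime) {n : ℤ}
    (h : ∀ h ∈ H, ¬ ((p : ℤ) ∣ n + h)) : localU H p n = localH H p := by
  rw [localU, localInd_of_forall h, localH_eq hadm hp]

/-- `u_p(n) = -1` when `p ∣ F(n)`. [folklore] -/
theorem localU_of_exists {p : ℕ} {n : ℤ} (h : ∃ h ∈ H, (p : ℤ) ∣ n + h) :
    localU H p n = -1 := by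
  rw [localU, localInd_of_exists h, zero_div, zero_sub]

/-- `|u_p(n)| ≤ max(h_p, 1)`-type dichotomy: `|u_p(n)|` is `h_p` or `1`. [folklore] -/
theorem abs_localU_eq (hadm : IsAdmissibleTuple H) {p : ℕ} (hp : p.Prime) (n : ℤ) :
    |localU H p n| = if ∀ h ∈ H, ¬ ((p : ℤ) ∣ n + h) then localH H p else 1 := by
  split_ifs with h
  · rw [localU_of_forall hadm hp h, abs_of_nonneg (localH_nonneg hp.pos)]
  · push Not at h
    rw [localU_of_exists h]
    norm_num

/-! ### `levelSets`, `G(R)`, `α_R`, `β_R` -/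

/-- Membership in `levelSets R`. [folklore] -/
theorem mem_levelSets {R : ℕ} {S : Finset ℕ} :
    S ∈ levelSets R ↔ S ⊆ Nat.primesLE R ∧ ∏ p ∈ S, p ≤ R := by
  simp [levelSets]

/-- `∅ ∈ levelSets R` for `R ≥ 1`. [folklore] -/
theorem empty_mem_levelSets {R : ℕ} (hR : 1 ≤ R) : (∅ : Finset ℕ) ∈ levelSets R := by
  rw [mem_levelSets]
  exact ⟨empty_subset _, by simpa using hR⟩

/-- Elements of a level set are primes `≤ R`. [folklore] -/
theorem prime_of_mem_of_mem_levelSets {R : ℕ} {S : Finset ℕ} (hS : S ∈ levelSets R) {p : ℕ}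
    (hp : p ∈ S) : p.Prime :=
  Nat.prime_of_mem_primesLE ((mem_levelSets.1 hS).1 hp)

/-- A subset of a level set is a level set. [folklore] -/
theorem subset_mem_levelSets {R : ℕ} {S T : Finset ℕ} (hS : S ∈ levelSets R) (hTS : T ⊆ S) :
    T ∈ levelSets R := by
  rw [mem_levelSets] at hS ⊢
  refine ⟨hTS.trans hS.1, le_trans ?_ hS.2⟩
  exact Finset.prod_le_prod_of_subset_of_one_le' hTS fun _ hp _ =>
    (Nat.prime_of_mem_primesLE (hS.1 hp)).one_le

/-- Every summand of `G(R)` is nonnegative. [folklore] -/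
theorem prod_localH_nonneg {R : ℕ} {S : Finset ℕ} (hS : S ∈ levelSets R) :
    0 ≤ ∏ p ∈ S, localH H p :=
  Finset.prod_nonneg fun _ hp => localH_nonneg (prime_of_mem_of_mem_levelSets hS hp).pos

/-- `G(R) ≥ 1` (the summand `S = ∅` is `1`, the others are `≥ 0`); in particular `G(R) > 0`
[GreenTao2006Restriction, Remark after (7.13)]. [cite: GreenTao2006Restriction, §7 Remark after (7.13)] -/
theorem one_le_selbergG {R : ℕ} (hR : 1 ≤ R) : 1 ≤ selbergG H R := by
  unfold selbergG
  calc (1 : ℝ) = ∏ p ∈ (∅ : Finset ℕ), localH H p := by simp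
    _ ≤ ∑ S ∈ levelSets R, ∏ p ∈ S, localH H p :=
        Finset.single_le_sum (fun _ hS => prod_localH_nonneg hS) (empty_mem_levelSets hR)

/-- `G(R) > 0` for `R ≥ 1`. [cite: GreenTao2006Restriction, §7 Remark after (7.13)] -/
theorem selbergG_pos {R : ℕ} (hR : 1 ≤ R) : 0 < selbergG H R :=
  lt_of_lt_of_le one_pos (one_le_selbergG hR)

/-- `G(R) ≥ 0` always. [folklore] -/
theorem selbergG_nonneg (R : ℕ) : 0 ≤ selbergG H R :=
  Finset.sum_nonneg fun _ hS => prod_localH_nonneg hS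

/-- **GT Lemma 7.5**: for `n ∈ X_{R!}` (no prime `p ≤ R` divides any `n + h`) one has
`α_R(n) = G(R)`. [cite: GreenTao2006Restriction, Lemma 7.5] -/
theorem alphaR_eq_selbergG (hadm : IsAdmissibleTuple H) {R : ℕ} {n : ℤ}
    (hn : ∀ p : ℕ, p.Prime → p ≤ R → ∀ h ∈ H, ¬ ((p : ℤ) ∣ n + h)) :
    alphaR H R n = selbergG H R := by
  unfold alphaR selbergG
  refine Finset.sum_congr rfl fun S hS => Finset.prod_congr rfl fun p hp => ?_
  have hp' := (mem_levelSets.1 hS).1 hp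
  rw [Nat.mem_primesLE] at hp'
  exact localU_of_forall hadm hp'.2 (hn p hp'.2 hp'.1)

/-- `β_R ≥ 0`. [cite: GreenTao2006Restriction, Prop. 3.1] -/
theorem betaR_nonneg (R : ℕ) (n : ℤ) : 0 ≤ betaR H R n :=
  div_nonneg (sq_nonneg _) (selbergG_nonneg R)

/-- `β_R(n) = G(R)` for `n ∈ X_{R!}`. [cite: GreenTao2006Restriction, §7, sentence after (7.14)] -/
theorem betaR_eq_selbergG (hadm : IsAdmissibleTuple H) {R : ℕ} (hR : 1 ≤ R) {n : ℤ}
    (hn : ∀ p : ℕ, p.Prime → p ≤ R → ∀ h ∈ H, ¬ ((p : ℤ) ∣ n + h)) :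
    betaR H R n = selbergG H R := by
  rw [betaR, alphaR_eq_selbergG hadm hn, sq, mul_div_assoc, div_self (selbergG_pos hR).ne',
    mul_one]

/-! ### The pointwise bound `|α_R(n)| ≤ G(R) · #{M ⊆ Z(n) : ∏ M ≤ R}` -/

/-- `Z(n) = Z_R(n)`: the primes `p ≤ R` dividing `F(n) = ∏_{h ∈ H} (n + h)`. [folklore] -/
def badPrimes (H : Finset ℤ) (R : ℕ) (n : ℤ) : Finset ℕ :=
  (Nat.primesLE R).filter (fun p => ∃ h ∈ H, (p : ℤ) ∣ n + h)

/-- `d_R(n) = #{M ⊆ Z(n) : ∏ M ≤ R}`, the number of squarefree `m ≤ R` dividing `F(n)` (as sets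
of primes). [folklore] -/
def divCount (H : Finset ℤ) (R : ℕ) (n : ℤ) : ℕ :=
  ((badPrimes H R n).powerset.filter (fun M => ∏ p ∈ M, p ≤ R)).card

/-- Membership in `Z(n)`. [folklore] -/
theorem mem_badPrimes {R : ℕ} {n : ℤ} {p : ℕ} :
    p ∈ badPrimes H R n ↔ p ∈ Nat.primesLE R ∧ ∃ h ∈ H, (p : ℤ) ∣ n + h := by
  simp [badPrimes]

/-- `|∏_{p ∈ S} u_p(n)| = ∏_{p ∈ S \ Z(n)} h_p` for a level set `S`. [folklore] -/
theorem abs_prod_localU_eq (hadm : IsAdmissibleTuple H) {R : ℕ} {S : Finset ℕ}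
    (hS : S ∈ levelSets R) (n : ℤ) :
    |∏ p ∈ S, localU H p n| = ∏ p ∈ S \ badPrimes H R n, localH H p := by
  rw [Finset.abs_prod]
  rw [← Finset.prod_sdiff (Finset.sdiff_subset (s := S) (t := badPrimes H R n))]
  have h1 : ∏ p ∈ S \ (S \ badPrimes H R n), |localU H p n| = 1 := by
    refine Finset.prod_eq_one fun p hp => ?_
    rw [Finset.mem_sdiff, Finset.mem_sdiff] at hp
    push Not at hp
    have hpZ := hp.2 hp.1
    rw [mem_badPrimes] at hpZ
    rw [abs_localU_eq hadm (prime_of_mem_of_mem_levelSets hS hp.1), if_neg]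
    push Not
    exact hpZ.2
  rw [h1, one_mul]
  refine Finset.prod_congr rfl fun p hp => ?_
  rw [Finset.mem_sdiff] at hp
  have hprime := prime_of_mem_of_mem_levelSets hS hp.1
  rw [abs_localU_eq hadm hprime, if_pos]
  intro h hh hdvd
  exact hp.2 (mem_badPrimes.2 ⟨(mem_levelSets.1 hS).1 hp.1, h, hh, hdvd⟩)

/-- **Pointwise bound** (replaces GT Lemmas 7.7–7.8): `|α_R(n)| ≤ G(R) · d_R(n)`.  Indeed
`|α_R(n)| ≤ ∑_S ∏_{p ∈ S∖Z(n)} h_p`, and grouping `S` by `M = S ∩ Z(n)` (a set with `∏ M ≤ R`),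
`S ↦ S ∖ Z(n)` is injective on each fibre with values in `levelSets R`.
[cite: GreenTao2006Restriction, Lemmas 7.7–7.8 and proof of Prop. 3.1 (ii)] -/
theorem abs_alphaR_le (hadm : IsAdmissibleTuple H) (R : ℕ) (n : ℤ) :
    |alphaR H R n| ≤ selbergG H R * divCount H R n := by
  set Z := badPrimes H R n with hZ
  set D := (Z.powerset.filter (fun M => ∏ p ∈ M, p ≤ R)) with hD
  have hcount : divCount H R n = D.card := rfl
  -- `|α_R(n)| ≤ ∑_S h(S \ Z)`
  have h1 : |alphaR H R n| ≤ ∑ S ∈ levelSets R, ∏ p ∈ S \ Z, localH H p := by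
    unfold alphaR
    refine (Finset.abs_sum_le_sum_abs _ _).trans (le_of_eq ?_)
    exact Finset.sum_congr rfl fun S hS => abs_prod_localU_eq hadm hS n
  refine h1.trans ?_
  -- group by `M = S ∩ Z`
  have hmaps : ∀ S ∈ levelSets R, S ∩ Z ∈ D := by
    intro S hS
    rw [hD, Finset.mem_filter, Finset.mem_powerset]
    exact ⟨Finset.inter_subset_right, (mem_levelSets.1
      (subset_mem_levelSets hS Finset.inter_subset_left)).2⟩
  rw [← Finset.sum_fiberwise_of_maps_to hmaps]
  have hfib : ∀ M ∈ D,
      ∑ S ∈ (levelSets R).filter (fun S => S ∩ Z = M), ∏ p ∈ S \ Z, localH H p ≤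
        selbergG H R := by
    intro M _
    have hinj : Set.InjOn (fun S : Finset ℕ => S \ Z)
        ↑((levelSets R).filter (fun S => S ∩ Z = M)) := by
      intro S hS T hT hST
      simp only [Finset.coe_filter, Set.mem_setOf_eq] at hS hT
      have hS' : S = (S \ Z) ∪ (S ∩ Z) := (Finset.sdiff_union_inter S Z).symm
      have hT' : T = (T \ Z) ∪ (T ∩ Z) := (Finset.sdiff_union_inter T Z).symm
      rw [hS', hT', hS.2, hT.2]
      simp only at hST
      rw [hST]
    calc ∑ S ∈ (levelSets R).filter (fun S => S ∩ Z = M), ∏ p ∈ S \ Z, localH H p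
        = ∑ T ∈ ((levelSets R).filter (fun S => S ∩ Z = M)).image (fun S => S \ Z),
            ∏ p ∈ T, localH H p :=
          (Finset.sum_image (f := fun T => ∏ p ∈ T, localH H p) hinj).symm
      _ ≤ ∑ T ∈ levelSets R, ∏ p ∈ T, localH H p := by
          refine Finset.sum_le_sum_of_subset_of_nonneg ?_ fun T hT _ => prod_localH_nonneg hT
          intro T hT
          rw [Finset.mem_image] at hT
          obtain ⟨S, hS, rfl⟩ := hT
          exact subset_mem_levelSets (Finset.mem_filter.1 hS).1 Finset.sdiff_subset
      _ = selbergG H R := rfl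
  calc ∑ M ∈ D, ∑ S ∈ (levelSets R).filter (fun S => S ∩ Z = M), ∏ p ∈ S \ Z, localH H p
      ≤ ∑ M ∈ D, selbergG H R := Finset.sum_le_sum hfib
    _ = selbergG H R * divCount H R n := by
        rw [Finset.sum_const, nsmul_eq_mul, hcount, mul_comm]

/-- `β_R(n) ≤ G(R) · d_R(n)²`. [cite: GreenTao2006Restriction, proof of Prop. 3.1 (ii)] -/
theorem betaR_le (hadm : IsAdmissibleTuple H) {R : ℕ} (hR : 1 ≤ R) (n : ℤ) :
    betaR H R n ≤ selbergG H R * (divCount H R n : ℝ) ^ 2 := by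
  have hG := selbergG_pos (H := H) hR
  have h := abs_alphaR_le hadm R n
  unfold betaR
  rw [div_le_iff₀ hG, ← sq_abs]
  have h0 : 0 ≤ |alphaR H R n| := abs_nonneg _
  calc |alphaR H R n| ^ 2 ≤ (selbergG H R * divCount H R n) ^ 2 :=
        pow_le_pow_left₀ h0 h 2
    _ = selbergG H R * (divCount H R n : ℝ) ^ 2 * selbergG H R := by ring


/-! ### Counting residues: `#{m < p : p ∣ m + h for some h} = ν_H(p)` -/

/-- The residues `m mod p` with `p ∣ F(m)` are exactly the classes `-h`, `h ∈ H`; there are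
`ν_H(p)` of them. [cite: GreenTao2006Restriction, (7.1)] -/
theorem card_filter_range_dvd {p : ℕ} (hp : 0 < p) :
    ((range p).filter (fun m : ℕ => ∃ h ∈ H, (p : ℤ) ∣ (m : ℤ) + h)).card =
      tupleResidueCount H p := by
  haveI : NeZero p := NeZero.of_pos hp
  set T : Finset (ZMod p) := (H.image (fun h : ℤ => (h : ZMod p))).image Neg.neg with hT
  have hTcard : T.card = tupleResidueCount H p := by
    rw [hT, Finset.card_image_of_injective _ neg_injective]
    rfl
  rw [← hTcard]
  refine Finset.card_nbij (fun m : ℕ => (m : ZMod p)) ?_ ?_ ?_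
  · intro m hm
    rw [Finset.mem_coe, Finset.mem_filter] at hm
    obtain ⟨h, hh, hdvd⟩ := hm.2
    rw [hT, Finset.mem_coe, Finset.mem_image]
    refine ⟨(h : ZMod p), Finset.mem_image_of_mem _ hh, ?_⟩
    have h0 : (((m : ℤ) + h : ℤ) : ZMod p) = 0 :=
      (ZMod.intCast_zmod_eq_zero_iff_dvd _ p).2 hdvd
    push_cast at h0
    linear_combination -h0
  · intro m₁ hm₁ m₂ hm₂ h12
    rw [Finset.mem_coe, Finset.mem_filter, Finset.mem_range] at hm₁ hm₂
    have h1 : (m₁ : ZMod p).val = m₁ := ZMod.val_cast_of_lt hm₁.1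
    have h2 : (m₂ : ZMod p).val = m₂ := ZMod.val_cast_of_lt hm₂.1
    simp only at h12
    rw [← h1, ← h2, h12]
  · intro t ht
    rw [hT, Finset.coe_image, Finset.coe_image] at ht
    obtain ⟨x, ⟨h, hh, rfl⟩, rfl⟩ := ht
    refine ⟨(-(h : ZMod p) : ZMod p).val, ?_, ZMod.natCast_zmod_val _⟩
    rw [Finset.mem_coe, Finset.mem_filter, Finset.mem_range]
    refine ⟨ZMod.val_lt _, h, Finset.mem_coe.1 hh, ?_⟩
    rw [← ZMod.intCast_zmod_eq_zero_iff_dvd]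
    push_cast
    rw [ZMod.natCast_zmod_val]
    ring

/-- `#{m < p : p ∤ F(m)} = p - ν_H(p)`. [cite: GreenTao2006Restriction, (7.1)] -/
theorem card_filter_range_not_dvd {p : ℕ} (hp : 0 < p) :
    (((range p).filter (fun m : ℕ => ∀ h ∈ H, ¬ ((p : ℤ) ∣ (m : ℤ) + h))).card : ℝ) =
      p - tupleResidueCount H p := by
  have h := Finset.card_filter_add_card_filter_not
    (s := range p) (fun m : ℕ => ∀ h ∈ H, ¬ ((p : ℤ) ∣ (m : ℤ) + h))
  rw [Finset.card_range] at h
  have h2 : ((range p).filter (fun m : ℕ => ¬ ∀ h ∈ H, ¬ ((p : ℤ) ∣ (m : ℤ) + h))).card =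
      tupleResidueCount H p := by
    rw [← card_filter_range_dvd hp]
    congr 1
    refine Finset.filter_congr fun m _ => ?_
    push Not
    rfl
  rw [h2] at h
  have h' : (((range p).filter (fun m : ℕ => ∀ h ∈ H, ¬ ((p : ℤ) ∣ (m : ℤ) + h))).card : ℝ) +
      tupleResidueCount H p = p := by exact_mod_cast h
  linarith

/-- `∑_{m<p} x_p(m) = p - ν_H(p)`. [folklore] -/
theorem sum_range_localInd {p : ℕ} (hp : 0 < p) :
    ∑ m ∈ range p, localInd H p m = p - tupleResidueCount H p := by
  unfold localInd
  rw [Finset.sum_boole]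
  exact card_filter_range_not_dvd hp

/-- `∑_{m<p} u_p(m) = 0`: `u_p` has mean zero. [cite: GreenTao2006Restriction, Lemma 7.3 (i)] -/
theorem sum_range_localU (hadm : IsAdmissibleTuple H) {p : ℕ} (hp : p.Prime) :
    ∑ m ∈ range p, localU H p m = 0 := by
  unfold localU
  rw [Finset.sum_sub_distrib, ← Finset.sum_div, sum_range_localInd hp.pos, Finset.sum_const,
    Finset.card_range, nsmul_eq_mul, mul_one, ← mul_localDensity hp.pos, mul_div_assoc,
    div_self (localDensity_pos hadm hp).ne', mul_one, sub_self]

/-- `∑_{m<p} |u_p(m)| = 2 ν_H(p)`. [folklore] -/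
theorem sum_range_abs_localU (hadm : IsAdmissibleTuple H) {p : ℕ} (hp : p.Prime) :
    ∑ m ∈ range p, |localU H p m| = 2 * tupleResidueCount H p := by
  simp_rw [abs_localU_eq hadm hp]
  rw [Finset.sum_ite, Finset.sum_const, Finset.sum_const, nsmul_eq_mul, nsmul_eq_mul, mul_one,
    card_filter_range_not_dvd hp.pos]
  have h2 : (((range p).filter (fun m : ℕ => ¬ ∀ h ∈ H, ¬ ((p : ℤ) ∣ (m : ℤ) + h))).card : ℝ) =
      tupleResidueCount H p := by
    rw [← card_filter_range_dvd (H := H) hp.pos]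
    congr 2
    refine Finset.filter_congr fun m _ => ?_
    push Not
    rfl
  rw [h2]
  have hν : (tupleResidueCount H p : ℝ) < p := by exact_mod_cast hadm p hp
  unfold localH
  have : (p : ℝ) - tupleResidueCount H p ≠ 0 := by linarith
  field_simp
  ring

/-- `∑_{m<p} u_p(m)² = p h_p` (`𝔼 u_p² = h_p`). [folklore] -/
theorem sum_range_localU_sq (hadm : IsAdmissibleTuple H) {p : ℕ} (hp : p.Prime) :
    ∑ m ∈ range p, localU H p m ^ 2 = p * localH H p := by
  have habs : ∀ m : ℕ, localU H p m ^ 2 = |localU H p m| ^ 2 := fun m => (sq_abs _).symm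
  simp_rw [habs, abs_localU_eq hadm hp, ite_pow, one_pow]
  rw [Finset.sum_ite, Finset.sum_const, Finset.sum_const, nsmul_eq_mul, nsmul_eq_mul, mul_one,
    card_filter_range_not_dvd hp.pos]
  have h2 : (((range p).filter (fun m : ℕ => ¬ ∀ h ∈ H, ¬ ((p : ℤ) ∣ (m : ℤ) + h))).card : ℝ) =
      tupleResidueCount H p := by
    rw [← card_filter_range_dvd (H := H) hp.pos]
    congr 2
    refine Finset.filter_congr fun m _ => ?_
    push Not
    rfl
  rw [h2]
  have hν : (tupleResidueCount H p : ℝ) < p := by exact_mod_cast hadm p hp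
  unfold localH
  have : (p : ℝ) - tupleResidueCount H p ≠ 0 := by linarith
  field_simp
  ring

/-! ### Finite Fourier analysis on `ℤ/pℤ` -/

/-- The `c`-th Fourier coefficient of a `p`-periodic `v : ℤ → ℂ`:
`v̂(c) = p⁻¹ ∑_{m<p} v(m) e(-cm/p)`. [folklore] -/
def dftCoeff (p : ℕ) (v : ℤ → ℂ) (c : ℕ) : ℂ :=
  (p : ℂ)⁻¹ * ∑ m ∈ range p, v m * e (-((c : ℝ) * m / p))

/-- `|v̂(c)| ≤ p⁻¹ ∑_{m<p} |v(m)|`. [folklore] -/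
theorem norm_dftCoeff_le (p : ℕ) (v : ℤ → ℂ) (c : ℕ) :
    ‖dftCoeff p v c‖ ≤ (p : ℝ)⁻¹ * ∑ m ∈ range p, ‖v m‖ := by
  unfold dftCoeff
  rw [norm_mul, norm_inv, Complex.norm_natCast]
  gcongr
  refine (norm_sum_le _ _).trans (le_of_eq (Finset.sum_congr rfl fun m _ => ?_))
  rw [norm_mul, norm_e, mul_one]

/-- **Fourier inversion on `ℤ/pℤ`**: a `p`-periodic `v` satisfies
`v(n) = ∑_{c<p} v̂(c) e(cn/p)` for all `n ∈ ℤ`. [folklore] -/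
theorem dft_inversion {p : ℕ} (hp : 0 < p) (v : ℤ → ℂ) (hv : ∀ n k : ℤ, v (n + p * k) = v n)
    (n : ℤ) : v n = ∑ c ∈ range p, dftCoeff p v c * e ((c : ℝ) * n / p) := by
  have hp0 : (p : ℂ) ≠ 0 := by exact_mod_cast hp.ne'
  have hpz : (0 : ℤ) < p := by exact_mod_cast hp
  -- the unique residue `m₀ < p` with `p ∣ n - m₀`
  set m₀ : ℕ := (n % p).toNat with hm₀
  have hm₀z : (m₀ : ℤ) = n % p := Int.toNat_of_nonneg (Int.emod_nonneg _ (by exact_mod_cast hp.ne'))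
  have hm₀lt : m₀ < p := by
    have : (m₀ : ℤ) < p := by rw [hm₀z]; exact Int.emod_lt_of_pos _ hpz
    exact_mod_cast this
  have hdiv : ∀ m ∈ range p, ((p : ℤ) ∣ n - m ↔ m = m₀) := by
    intro m hm
    rw [Finset.mem_range] at hm
    constructor
    · intro hd
      have h1 : (m : ℤ) % p = n % p := Int.modEq_iff_dvd.2 hd
      have h2 : (m : ℤ) % p = m := Int.emod_eq_of_lt (by positivity) (by exact_mod_cast hm)
      have : (m : ℤ) = m₀ := by rw [hm₀z, ← h1, h2]
      exact_mod_cast this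
    · rintro rfl
      rw [hm₀z]
      refine ⟨n / p, ?_⟩
      linarith [Int.emod_add_mul_ediv n p]
  calc v n = v m₀ := by
        have : n = m₀ + p * (n / p) := by rw [hm₀z]; linarith [Int.emod_add_mul_ediv n p]
        rw [this, hv]
    _ = (p : ℂ)⁻¹ * ∑ m ∈ range p, v m * (if (p : ℤ) ∣ n - m then (p : ℂ) else 0) := by
        rw [Finset.sum_eq_single_of_mem m₀ (Finset.mem_range.2 hm₀lt)]
        · rw [if_pos ((hdiv m₀ (Finset.mem_range.2 hm₀lt)).2 rfl)]
          field_simp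
        · intro m hm hne
          rw [if_neg (fun h => hne ((hdiv m hm).1 h)), mul_zero]
    _ = (p : ℂ)⁻¹ * ∑ m ∈ range p, v m * ∑ c ∈ range p, e ((c : ℝ) * (n - m : ℤ) / p) := by
        simp_rw [RamanujanSum.sum_range_fourierChar_div hp.ne']
    _ = ∑ c ∈ range p, dftCoeff p v c * e ((c : ℝ) * n / p) := by
        unfold dftCoeff
        simp_rw [Finset.mul_sum, Finset.sum_mul]
        rw [Finset.sum_comm]
        refine Finset.sum_congr rfl fun c _ => Finset.sum_congr rfl fun m _ => ?_
        have : e ((c : ℝ) * ((n - m : ℤ) : ℝ) / p) =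
            e (-((c : ℝ) * m / p)) * e ((c : ℝ) * n / p) := by
          rw [← e_add]; congr 1; push_cast; ring
        rw [this]; ring

/-! ### The Fourier coefficients of `u_p` and `u_p²` -/

/-- `x_p` is `p`-periodic. [folklore] -/
theorem localInd_add_mul (p : ℕ) (n k : ℤ) : localInd H p (n + p * k) = localInd H p n := by
  unfold localInd
  have : ∀ h : ℤ, ((p : ℤ) ∣ n + p * k + h ↔ (p : ℤ) ∣ n + h) := fun h => by
    rw [show n + p * k + h = n + h + p * k by ring]
    exact dvd_add_left (dvd_mul_right _ _) |>.symm.symm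
  simp_rw [this]

/-- `u_p` is `p`-periodic. [folklore] -/
theorem localU_add_mul (p : ℕ) (n k : ℤ) : localU H p (n + p * k) = localU H p n := by
  unfold localU; rw [localInd_add_mul]

/-- `û_p(0) = 0`. [cite: GreenTao2006Restriction, Lemma 7.3 (i) / (7.15)] -/
theorem dftCoeff_localU_zero (hadm : IsAdmissibleTuple H) {p : ℕ} (hp : p.Prime) :
    dftCoeff p (fun n => (localU H p n : ℂ)) 0 = 0 := by
  unfold dftCoeff
  have : ∀ m : ℕ, e (-((((0 : ℕ) : ℝ)) * m / p)) = 1 := fun m => by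
    rw [Nat.cast_zero, zero_mul, zero_div, neg_zero, e_zero]
  simp_rw [this, mul_one]
  rw [← Complex.ofReal_sum]
  have h := sum_range_localU hadm hp
  rw [show (∑ m ∈ range p, localU H p (m : ℕ)) = ∑ m ∈ range p, localU H p m from rfl] at h
  rw [h, Complex.ofReal_zero, mul_zero]

/-- `|û_p(c)| ≤ 2 h_p` for every `c` (from `∑_{m<p} |u_p(m)| = 2ν_p` and `ν_p/p ≤ h_p`).
[cite: GreenTao2006Restriction, Lemma 7.3 (vi)] -/
theorem norm_dftCoeff_localU_le (hadm : IsAdmissibleTuple H) {p : ℕ} (hp : p.Prime) (c : ℕ) :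
    ‖dftCoeff p (fun n => (localU H p n : ℂ)) c‖ ≤ 2 * localH H p := by
  refine (norm_dftCoeff_le p _ c).trans ?_
  have h1 : ∑ m ∈ range p, ‖((localU H p m : ℝ) : ℂ)‖ = 2 * tupleResidueCount H p := by
    rw [← sum_range_abs_localU hadm hp]
    refine Finset.sum_congr rfl fun m _ => ?_
    rw [Complex.norm_real, Real.norm_eq_abs]
  rw [h1]
  have hp0 : (0 : ℝ) < p := by exact_mod_cast hp.pos
  have hν : (tupleResidueCount H p : ℝ) < p := by exact_mod_cast hadm p hp
  have hν0 : (0 : ℝ) ≤ tupleResidueCount H p := Nat.cast_nonneg _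
  unfold localH
  have hsub : 0 < (p : ℝ) - tupleResidueCount H p := by linarith
  rw [inv_mul_le_iff₀ hp0, ← mul_div_assoc, ← mul_div_assoc, le_div_iff₀ hsub]
  nlinarith [sq_nonneg (tupleResidueCount H p : ℝ)]

/-- `|(u_p²)^(c)| ≤ h_p` for every `c` (from `∑_{m<p} u_p(m)² = p h_p`).
[cite: GreenTao2006Restriction, Prop. 7.1 (7.19)] -/
theorem norm_dftCoeff_localU_sq_le (hadm : IsAdmissibleTuple H) {p : ℕ} (hp : p.Prime) (c : ℕ) :
    ‖dftCoeff p (fun n => ((localU H p n ^ 2 : ℝ) : ℂ)) c‖ ≤ localH H p := by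
  refine (norm_dftCoeff_le p _ c).trans ?_
  have h1 : ∑ m ∈ range p, ‖((localU H p m ^ 2 : ℝ) : ℂ)‖ = p * localH H p := by
    rw [← sum_range_localU_sq hadm hp]
    refine Finset.sum_congr rfl fun m _ => ?_
    rw [Complex.norm_real, Real.norm_eq_abs, abs_of_nonneg (sq_nonneg _)]
  rw [h1, ← mul_assoc, inv_mul_cancel₀ (by exact_mod_cast hp.ne_zero), one_mul]

/-- Fourier inversion for `u_p`: `u_p(n) = ∑_{c<p} û_p(c) e(cn/p)`. [folklore] -/
theorem localU_eq_sum_dftCoeff {p : ℕ} (hp : 0 < p) (n : ℤ) :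
    (localU H p n : ℂ) =
      ∑ c ∈ range p, dftCoeff p (fun n => (localU H p n : ℂ)) c * e ((c : ℝ) * n / p) :=
  dft_inversion hp (fun n => (localU H p n : ℂ)) (fun n k => by
    simp only [localU_add_mul]) n

/-- Fourier inversion for `u_p²`. [folklore] -/
theorem localU_sq_eq_sum_dftCoeff {p : ℕ} (hp : 0 < p) (n : ℤ) :
    ((localU H p n ^ 2 : ℝ) : ℂ) =
      ∑ c ∈ range p, dftCoeff p (fun n => ((localU H p n ^ 2 : ℝ) : ℂ)) c *
        e ((c : ℝ) * n / p) :=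
  dft_inversion hp (fun n => ((localU H p n ^ 2 : ℝ) : ℂ)) (fun n k => by
    simp only [localU_add_mul]) n

end GreenTao2006

end Literature.NumberTheory.Sieve
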